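import Summits.CriticalPhenomena.PercolationContinuityZ3.Theorems.PercNearOneGluingNoHeavyQuantTwoPointHubSliver
import Summits.CriticalPhenomena.PercolationContinuityZ3.Theorems.PercNearOneGluingNoHeavyQuantIndepBlobTwoLevelRow
import HarnessLib

/-!
# QUANT lane R8, FAR on trees: TP1 in the sliver is a THEOREM when every block gate is `≥ 1/2`

builds on p205010 (kernel theorem, internal audit signed; external expert review pending)

Support file (`--supports stmt-CriticalPhenomena-4575`), QUANT lane seat prim-quant-census-1 (gen 11); memo
`run/shared/lean/prim/quant/prim-quant-census-1/B4-SLIVER-G11.md` §2, §4.  Theorems only; no sorries; standard axioms.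

`Quant.IndepBlob.twoPointHub_sliver_of_half_le_gate`: in the setting of `Quant.IndepBlob.twoPointHub_sliver_of_rows` (blob sum `W`, integer sizes
`a k ≥ 1`, least reliable blob `y₀` with gate `g`; integers `1 ≤ i`, `i + 1 ≤ c`, `c + 1 ≤ y`; `d ∈ (0,1)`, `i + d < c`; `EW > 2y − 2 − d`), if every
gate is `≥ 1/2` then UNCONDITIONALLY `min((2i+d)/(i+c), g) ≤ (1 − λ)·P(y ≤ W) + λ·P(y − c ≤ W)`, `λ = (i+d)/c`: the two rows are supplied by
`Quant.IndepBlob.twoLevelRow_of_half_le_gate` (levels `y`, `y − 2`; `2(y−2) + 1 = 2y − 3 < EW`) and `Quant.IndepBlob.tail_ge_gate_of_two_mul_le_size`.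
This is the two-point-hub inequality TP1 of census-2 gen 46 (the vertex to which (B-4) of PROFILE-PROOF-G10 reduces) in the sliver regime, for the
Hall–Harris half of the gate range; the half with least gate `< 1/2` waits for lemma (U) of the memo (`π(y) ≥ g` outright when `g ≤ 1/2`, `y ≥ 3`).
[this work]
-/

namespace Summit.CriticalPhenomena.PercolationContinuityZ3.Theorems

namespace Quant

namespace IndepBlob

open Finset

variable {κ : Type*} [Fintype κ] [DecidableEq κ]

/-- **TP1-sliver, all gates `≥ 1/2`.**  Gates `0 ≤ p k ≤ 1` with least reliable blob `y₀`, `1/2 ≤ p y₀`; integer sizes `a k ≥ 1`; integers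
`1 ≤ i`, `i + 1 ≤ c`, `c + 1 ≤ y`; a real `0 < d < 1` with `i + d < c`; and `2y − 2 − d < EW`.  Then
`min((2i+d)/(i+c), p y₀) ≤ (1 − (i+d)/c)·P(y ≤ W) + ((i+d)/c)·P(y − c ≤ W)`. [this work] -/
theorem twoPointHub_sliver_of_half_le_gate (p : κ → ℝ) (a : κ → ℕ) (hp0 : ∀ k, 0 ≤ p k) (hp1 : ∀ k, p k ≤ 1) (ha : ∀ k, 1 ≤ a k)
    (y₀ : κ) (hy₀ : ∀ k, p y₀ ≤ p k) (hhalf : 1 / 2 ≤ p y₀) (i c y : ℕ) (d : ℝ) (hi : 1 ≤ i) (hic : i + 1 ≤ c) (hcy : c + 1 ≤ y)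
    (hd0 : 0 < d) (hd1 : d < 1) (hdc : (i : ℝ) + d < c)
    (hEW : 2 * (y : ℝ) - 2 - d < ∑ k, (a k : ℝ) * p k) :
    min ((2 * (i : ℝ) + d) / ((i : ℝ) + c)) (p y₀) ≤
      (1 - ((i : ℝ) + d) / c) *
          ∑ s ∈ (Finset.univ : Finset (Finset κ)).filter (fun s => y ≤ ∑ k ∈ s, a k), (∏ k, if k ∈ s then p k else 1 - p k) +
        (((i : ℝ) + d) / c) *
          ∑ s ∈ (Finset.univ : Finset (Finset κ)).filter (fun s => y - c ≤ ∑ k ∈ s, a k), (∏ k, if k ∈ s then p k else 1 - p k) := by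
  refine twoPointHub_sliver_of_rows p a hp0 hp1 y₀ i c y d hi hic hcy hd0 hd1 hdc hEW (fun _ => ?_) (fun _ hT => ?_)
  · -- row (A') from the two-level row at level `y − 2`
    have hy2 : y - 2 + 2 = y := by omega
    have hcast : ((y - 2 : ℕ) : ℝ) = (y : ℝ) - 2 := by
      have : 2 ≤ y := by omega
      rw [Nat.cast_sub this]
      push_cast
      ring
    have h' : 2 * ((y - 2 : ℕ) : ℝ) + 1 < ∑ k, (a k : ℝ) * p k := by rw [hcast]; linarith
    have := twoLevelRow_of_half_le_gate p a hp0 hp1 ha y₀ hy₀ hhalf (y - 2) h'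
    rw [hy2] at this
    exact this
  · -- row (S) from the size row
    exact (min_le_right _ _).trans (tail_ge_gate_of_two_mul_le_size p a hp0 hp1 y₀ hy₀ hhalf y hT)
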